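import Summits.HubbardSuperconductivity.HubbardSuperconductivity.Theorems.WeakCouplingBCSKlLindhardEnclosureCrescent

/-!
# KL-MARGIN-SCAN reader (22) «kernel-lindhard-enclosure» — the PIECEWISE strip lemma (abstract form of the 2-D hyperbola variant `vAB`)

The 2-D variant of the majorised-hyperbola ceiling cuts the straddler's abscissa-cosine range `[A₀, A_N]` into `N` pieces
`[A_m, A_{m+1}]` (the kernel: `N = MA = 8`, `A_m = linGridZ αLo αUp MA m / 2^40`) and uses on each piece its own slope floor and crescent
extent.  Abstractly: if the inner integral `inner x ≥ 0` of a strip is `≤ K_m` whenever `cos (x + s)` lies in piece `m` (`K_m ≥ 0`), the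
breakpoints are monotone, `cos (x + s) ∈ [A₀, A_N]` and `τ ≤ |sin (x + s)|` on `[x0, x1]`, and `cos` is injective on the shifted interval, then
`∫_{[x0,x1]} inner ≤ τ⁻¹ · Σ_{m<N} K_m · (A_{m+1} − A_m)` (`pieces_strip_lemma`) — the abscissa substitution applied to the step majorant
`Kfun = Σ_m K_m · 𝟙[A_m, A_{m+1}]`.  Honest framing: elementary analysis; nothing in this file asserts a KL margin at any `t′ ≠ 0`, `K₃`,
`U₀`, the window or B1g dominance; a Kohn–Luttinger instability statement is not ODLRO and nothing here proves superconductivity in the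
Hubbard model.  (p1 g26, 2026-08-29.)
-/

noncomputable section

set_option linter.dupNamespace false

namespace Summit.HubbardSuperconductivity.HubbardSuperconductivity.Theorems.KlLindhardEnclosure

open Real Set MeasureTheory Finset
open Summit.HubbardSuperconductivity.HubbardSuperconductivity.Theorems

/-! ## §1 Monotone breakpoints cover their hull -/

/-- For monotone breakpoints `A 0 ≤ A 1 ≤ … ≤ A N`, every `a ∈ [A 0, A N]` lies in some piece `[A m, A (m+1)]`, `m < N` (for `0 < N`). -/
theorem exists_piece {A : ℕ → ℝ} {N : ℕ} (hN : 0 < N) (hmono : ∀ m, m < N → A m ≤ A (m + 1)) {a : ℝ} (h0 : A 0 ≤ a) (h1 : a ≤ A N) :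
    ∃ m, m < N ∧ A m ≤ a ∧ a ≤ A (m + 1) := by
  induction N with
  | zero => exact absurd hN (lt_irrefl 0)
  | succ N ih =>
    by_cases hN0 : N = 0
    · subst hN0; exact ⟨0, Nat.zero_lt_one, h0, h1⟩
    · by_cases hle : a ≤ A N
      · obtain ⟨m, hm, hm0, hm1⟩ := ih (Nat.pos_of_ne_zero hN0) (fun m hm => hmono m (Nat.lt_succ_of_lt hm)) hle
        exact ⟨m, Nat.lt_succ_of_lt hm, hm0, hm1⟩
      · push Not at hle
        exact ⟨N, Nat.lt_succ_self N, hle.le, h1⟩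

/-! ## §2 The step majorant -/

/-- The step majorant `Kfun A K N a = Σ_{m<N} K m · 𝟙[A m ≤ a ≤ A (m+1)]`. [folklore] -/
def Kfun (A : ℕ → ℝ) (K : ℕ → ℝ) (N : ℕ) (a : ℝ) : ℝ :=
  ∑ m ∈ range N, (Icc (A m) (A (m + 1))).indicator (fun _ => K m) a

/-- `Kfun ≥ 0` for non-negative constants. -/
theorem Kfun_nonneg {A K : ℕ → ℝ} {N : ℕ} (hK : ∀ m, m < N → 0 ≤ K m) (a : ℝ) : 0 ≤ Kfun A K N a := by
  unfold Kfun
  refine sum_nonneg fun m hm => ?_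
  by_cases ha : a ∈ Icc (A m) (A (m + 1))
  · rw [indicator_of_mem ha]; exact hK m (mem_range.mp hm)
  · rw [indicator_of_notMem ha]

/-- `Kfun ≤ Σ K` for non-negative constants. -/
theorem Kfun_le_sum {A K : ℕ → ℝ} {N : ℕ} (hK : ∀ m, m < N → 0 ≤ K m) (a : ℝ) : Kfun A K N a ≤ ∑ m ∈ range N, K m := by
  unfold Kfun
  refine sum_le_sum fun m hm => ?_
  by_cases ha : a ∈ Icc (A m) (A (m + 1))
  · rw [indicator_of_mem ha]
  · rw [indicator_of_notMem ha]; exact hK m (mem_range.mp hm)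

/-- A point of piece `m₀` picks up at least `K m₀`. -/
theorem le_Kfun {A K : ℕ → ℝ} {N : ℕ} (hK : ∀ m, m < N → 0 ≤ K m) {m₀ : ℕ} (hm₀ : m₀ < N) {a : ℝ}
    (ha : A m₀ ≤ a ∧ a ≤ A (m₀ + 1)) : K m₀ ≤ Kfun A K N a := by
  unfold Kfun
  have hsplit := sum_erase_add (range N) (fun m => (Icc (A m) (A (m + 1))).indicator (fun _ => K m) a) (mem_range.mpr hm₀)
  rw [← hsplit, indicator_of_mem (show a ∈ Icc (A m₀) (A (m₀ + 1)) from ha)]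
  have : 0 ≤ ∑ m ∈ (range N).erase m₀, (Icc (A m) (A (m + 1))).indicator (fun _ => K m) a := by
    refine sum_nonneg fun m hm => ?_
    by_cases ha' : a ∈ Icc (A m) (A (m + 1))
    · rw [indicator_of_mem ha']; exact hK m (mem_range.mp (mem_of_mem_erase hm))
    · rw [indicator_of_notMem ha']
  linarith

/-- The step majorant is measurable. -/
theorem measurable_Kfun (A K : ℕ → ℝ) (N : ℕ) : Measurable (Kfun A K N) := by
  unfold Kfun
  refine Finset.measurable_sum _ fun m _ => ?_
  exact (measurable_const.indicator measurableSet_Icc)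

/-- The integral of the step majorant over the hull of monotone breakpoints: `Σ K m · (A (m+1) − A m)`. -/
theorem setIntegral_Kfun {A K : ℕ → ℝ} {N : ℕ} (hmono : ∀ m, m < N → A m ≤ A (m + 1)) :
    ∫ a in Icc (A 0) (A N), Kfun A K N a = ∑ m ∈ range N, K m * (A (m + 1) - A m) := by
  -- every piece lies inside the hull
  have hchain : ∀ m, m ≤ N → A 0 ≤ A m ∧ A m ≤ A N := by
    intro m hm
    constructor
    · induction m with
      | zero => exact le_rfl
      | succ k ih => exact (ih (Nat.le_of_succ_le hm)).trans (hmono k (Nat.lt_of_succ_le hm))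
    · induction hm using Nat.decreasingInduction with
      | self => exact le_rfl
      | of_succ k hk ih => exact (hmono k hk).trans ih
  unfold Kfun
  rw [integral_finsetSum]
  · refine sum_congr rfl fun m hm => ?_
    have hm' := mem_range.mp hm
    rw [setIntegral_indicator measurableSet_Icc]
    have hsub : Icc (A m) (A (m + 1)) ⊆ Icc (A 0) (A N) := fun a ha =>
      ⟨(hchain m hm'.le).1.trans ha.1, ha.2.trans (hchain (m + 1) hm').2⟩
    rw [inter_eq_right.mpr hsub, setIntegral_const, smul_eq_mul, Real.volume_real_Icc_of_le (hmono m hm'), mul_comm]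
  · intro m _
    exact (integrableOn_const (hs := (measure_Icc_lt_top (μ := volume)).ne)).indicator measurableSet_Icc

/-! ## §3 The piecewise strip lemma -/

/-- **THE PIECEWISE STRIP LEMMA**: with monotone breakpoints `A`, non-negative constants `K`, a non-negative `inner` on `[x0, x1]` bounded by
`K m` whenever `cos (x + s)` lies in piece `m`, `cos (x + s) ∈ [A 0, A N]`, `τ ≤ |sin (x + s)|` (`0 < τ`) and `cos` injective on the shifted
interval: `∫_{[x0,x1]} inner ≤ τ⁻¹ · Σ_{m<N} K m · (A (m+1) − A m)`. -/
theorem pieces_strip_lemma {A K : ℕ → ℝ} {N : ℕ} (hN : 0 < N) (hmono : ∀ m, m < N → A m ≤ A (m + 1)) (hK : ∀ m, m < N → 0 ≤ K m)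
    {x0 x1 s τ : ℝ} (hx : x0 ≤ x1) (hτ : 0 < τ) (hsin : ∀ x ∈ Icc x0 x1, τ ≤ |Real.sin (x + s)|)
    (hcos : ∀ x ∈ Icc x0 x1, A 0 ≤ Real.cos (x + s) ∧ Real.cos (x + s) ≤ A N)
    (hinj : InjOn Real.cos (Icc (x0 + s) (x1 + s)))
    {inner : ℝ → ℝ} (h0 : ∀ x ∈ Icc x0 x1, 0 ≤ inner x)
    (hdom : ∀ x ∈ Icc x0 x1, ∀ m, m < N → A m ≤ Real.cos (x + s) → Real.cos (x + s) ≤ A (m + 1) → inner x ≤ K m) :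
    ∫ x in Icc x0 x1, inner x ≤ τ⁻¹ * ∑ m ∈ range N, K m * (A (m + 1) - A m) := by
  -- (1) dominate by the step majorant composed with the shifted cosine
  have hdom' : ∀ x ∈ Icc x0 x1, inner x ≤ Kfun A K N (Real.cos (x + s)) := by
    intro x hx
    obtain ⟨m, hm, hm0, hm1⟩ := exists_piece hN hmono (hcos x hx).1 (hcos x hx).2
    exact (hdom x hx m hm hm0 hm1).trans (le_Kfun hK hm ⟨hm0, hm1⟩)
  have hKi : IntegrableOn (fun x => Kfun A K N (Real.cos (x + s))) (Icc x0 x1) volume :=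
    Measure.integrableOn_of_bounded (measure_Icc_lt_top (μ := volume)).ne
      ((measurable_Kfun A K N).comp (by fun_prop : Measurable fun x => Real.cos (x + s))).aestronglyMeasurable
      (Filter.Eventually.of_forall fun x => by
        rw [Real.norm_of_nonneg (Kfun_nonneg hK _)]; exact Kfun_le_sum hK _)
  have h1 : ∫ x in Icc x0 x1, inner x ≤ ∫ x in Icc x0 x1, Kfun A K N (Real.cos (x + s)) := by
    apply integral_mono_of_nonneg
    · exact (ae_restrict_iff' measurableSet_Icc).mpr (Filter.Eventually.of_forall h0)
    · exact hKi
    · exact (ae_restrict_iff' measurableSet_Icc).mpr (Filter.Eventually.of_forall hdom')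
  -- (2) translate and substitute
  have h2 : (∫ x in Icc x0 x1, Kfun A K N (Real.cos (x + s))) = ∫ x in Icc (x0 + s) (x1 + s), Kfun A K N (Real.cos x) := by
    rw [integral_Icc_eq_integral_Ioc, integral_Icc_eq_integral_Ioc, ← intervalIntegral.integral_of_le hx,
      ← intervalIntegral.integral_of_le (by linarith), intervalIntegral.integral_comp_add_right (fun x => Kfun A K N (Real.cos x)) s]
  have hsin' : ∀ x ∈ Icc (x0 + s) (x1 + s), τ ≤ |Real.sin x| := by
    intro x hx'; have := hsin (x - s) ⟨by linarith [hx'.1], by linarith [hx'.2]⟩; simpa using this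
  have hcos' : ∀ x ∈ Icc (x0 + s) (x1 + s), A 0 ≤ Real.cos x ∧ Real.cos x ≤ A N := by
    intro x hx'; have := hcos (x - s) ⟨by linarith [hx'.1], by linarith [hx'.2]⟩; simpa using this
  have hKi' : IntegrableOn (fun x => Kfun A K N (Real.cos x)) (Icc (x0 + s) (x1 + s)) volume :=
    Measure.integrableOn_of_bounded (measure_Icc_lt_top (μ := volume)).ne
      ((measurable_Kfun A K N).comp Real.measurable_cos).aestronglyMeasurable
      (Filter.Eventually.of_forall fun x => by
        rw [Real.norm_of_nonneg (Kfun_nonneg hK _)]; exact Kfun_le_sum hK _)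
  have h3 := setIntegral_comp_cos_le hτ hinj hsin' (fun a => Kfun_nonneg hK a) hKi'
  -- (3) enlarge to the hull and integrate the step majorant
  have hsub := cos_image_subset_Icc hcos'
  have hKI : IntegrableOn (Kfun A K N) (Icc (A 0) (A N)) volume :=
    Measure.integrableOn_of_bounded (measure_Icc_lt_top (μ := volume)).ne (measurable_Kfun A K N).aestronglyMeasurable
      (Filter.Eventually.of_forall fun a => by
        rw [Real.norm_of_nonneg (Kfun_nonneg hK _)]; exact Kfun_le_sum hK _)
  have h4 := setIntegral_mono_of_subset_nonneg hsub (fun a => Kfun_nonneg hK a) hKI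
  rw [setIntegral_Kfun hmono] at h4
  calc ∫ x in Icc x0 x1, inner x ≤ ∫ x in Icc (x0 + s) (x1 + s), Kfun A K N (Real.cos x) := h1.trans (le_of_eq h2)
    _ ≤ τ⁻¹ * ∫ a in Real.cos '' Icc (x0 + s) (x1 + s), Kfun A K N a := h3
    _ ≤ τ⁻¹ * ∑ m ∈ range N, K m * (A (m + 1) - A m) := mul_le_mul_of_nonneg_left h4 (inv_nonneg.mpr hτ.le)

end Summit.HubbardSuperconductivity.HubbardSuperconductivity.Theorems.KlLindhardEnclosure

end
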